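import Summits.Ventures.LatticeQCDFlow.Scoring.SU2AxisCoordinateLaw
import Summits.Ventures.LatticeQCDFlow.Scoring.SU2CharacterExpansion
import HarnessLib

/-!
# SU(2): the two-angle disintegration of Haar measure and the CHARACTER CONVOLUTION IDENTITY `∫ χ_m(x_θ⁻¹ y) χ_n(y) dy = [m = n]·χ_n(x_θ)/(n+1)` — without Peter–Weyl

HONEST FRAMING: exact (Metropolis-corrected) sampling algorithms for lattice gauge theory;
figures of merit are autocorrelation/cost numbers at stated couplings and volumes; no
continuum-physics claim.

Venture `LatticeQCDFlow` (cell pub-lqcd), sub-topic `Scoring`; FANOUT row 5 (`s0-sun-a`), GEN-9.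
NEW WORK of the cell (placement rule).  Steps 3–4 of row 5's route to the exact SU(2) torus
formula: the "other half" of Peter–Weyl for SU(2) in the class-function form that face-merging on the
2-d lattice uses — `∫ χ_m(A U) χ_n(U⁻¹ B) dU = [m = n] χ_n(AB)/(n+1)` — obtained here by an EXPLICIT
two-angle computation, with no representation theory:

* §1 **`integral_a0_su2x_haar`** — the TWO-ANGLE DISINTEGRATION of Haar measure (from
  `SU2AxisCoordinateLaw.map_a0_axisCoord_haar`): for continuous `F`,
  `∫ F(a₀(U), x₁(U)) dHaar(U) = ∫_{−1}^{1} (½∫_{−1}^{1} F(t, √(1−t²)·s) ds)·(2/π)√(1−t²) dt`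
  (`(a₀, x₁)` is uniform on the unit disk; `x₁ = su2x genZ1 = −Re tr(Z₁U)/2`);
* §2 `mul_integral_chebyshevU_affine` — `(m+1)·w·∫_{−1}^{1} U_m(c + w s) ds = T_{m+1}(c+w) − T_{m+1}(c−w)`
  (`T'_{m+1} = (m+1) U_m`), whence **`mul_integral_chebyshevU_twoAngle`** —
  `(m+1)·sin θ sin a·∫_{−1}^{1} U_m(cos θ cos a + sin θ sin a·s) ds = 2 sin((m+1)θ) sin((m+1)a)`
  (`c ± w = cos(θ ∓ a)`, `T_{m+1}(cos x) = cos((m+1)x)`);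
* §3 **`integral_chebyshevU_twoAngle_mul_chebyshevU`** — for `sin θ ≠ 0` and all `m, n ∈ ℕ`,
  `∫ U_m(cos θ·a₀(U) + sin θ·x₁(U))·U_n(a₀(U)) dHaar(U) = [m = n]·U_n(cos θ)/(n+1)`.
  Since `cos θ·a₀(U) + sin θ·x₁(U) = a₀(x_θ⁻¹U)` for the one-parameter subgroup
  `x_θ = cos θ·1 + sin θ·Z₁` and `χ_n = U_n(a₀)` (`SU2CharacterExpansion.lean`), this IS the convolution
  identity `(χ_m ∗ χ_n)(x_θ) = [m = n] χ_n(x_θ)/(n+1)` at the elements `x_θ`; the ingredients are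
  §1, §2 and the orthogonality `∫₀^π sin((m+1)a) sin((n+1)a) da = (π/2)[m = n]`.

NOT here (next steps, NOT TYPED): the extension from `x_θ` to every `x ∈ SU(2)` (conjugation
invariance of the convolution and the rotation of the axis — or directly the same computation with
`⟨n̂, m̂⟩` for a general unit `m̂`, which needs the rotation invariance of `uniformSphere`);
completeness of `{χ_n}`; the handle identity `∫χ_n(AUBU⁻¹)dU = χ_n(A)χ_n(B)/(n+1)`; the lattice
assembly of the torus formula.
-/

noncomputable section

open Real MeasureTheory intervalIntegral Set Metric Polynomial.Chebyshev
open Literature.MathematicalPhysics.QuantumFieldTheory Literature.MathematicalPhysics.QuantumLattice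
open Summit.Ventures.LatticeQCDFlow.Exactness
open Summit.Ventures.LatticeQCDFlow.Theory2.Lattice

namespace Summit.Ventures.LatticeQCDFlow.Scoring

/-! ## §1. The two-angle disintegration of Haar measure on SU(2) -/

/-- The product law `semicircleLaw ⊗ ½·Lebesgue|[−1,1]` is carried by the square `[−1,1]²`. -/
theorem ae_mem_Icc_prod_Icc :
    ∀ᵐ p ∂(semicircleLaw.prod ((2⁻¹ : NNReal) • (volume.restrict (Icc (-1 : ℝ) 1)))),
      p ∈ Icc (-1 : ℝ) 1 ×ˢ Icc (-1 : ℝ) 1 := by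
  rw [ae_iff]
  have hsub : {p : ℝ × ℝ | ¬p ∈ Icc (-1 : ℝ) 1 ×ˢ Icc (-1 : ℝ) 1} ⊆
      (Icc (-1 : ℝ) 1)ᶜ ×ˢ (univ : Set ℝ) ∪ (univ : Set ℝ) ×ˢ (Icc (-1 : ℝ) 1)ᶜ := by
    intro p hp
    simp only [mem_setOf_eq, mem_prod, not_and_or] at hp
    rcases hp with h | h
    · exact Or.inl ⟨h, mem_univ _⟩
    · exact Or.inr ⟨mem_univ _, h⟩
  refine measure_mono_null hsub (measure_union_null ?_ ?_)
  · rw [Measure.prod_prod, semicircleLaw_compl_Icc, zero_mul]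
  · rw [Measure.prod_prod, Measure.smul_apply, Measure.restrict_apply measurableSet_Icc.compl,
      compl_inter_self, measure_empty, smul_zero, mul_zero]

/-- **The two-angle disintegration of Haar measure on SU(2).**  For every continuous
`F : ℝ → ℝ → ℝ`:
`∫ F(a₀(U), x₁(U)) dHaar_SU(2)(U) = ∫_{−1}^{1} (½ ∫_{−1}^{1} F(t, √(1 − t²)·s) ds)·(2/π)√(1 − t²) dt`,
`a₀ = Re tr U/2`, `x₁ = su2x genZ1 U` — the pair `(a₀, x₁)` is uniformly distributed on the unit
disk (`x₁ = √(1 − a₀²)·T` with `T` uniform on `[−1,1]` and independent of `a₀`). -/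
theorem integral_a0_su2x_haar (F : ℝ → ℝ → ℝ) (hF : Continuous (Function.uncurry F)) :
    ∫ U, F (su2a0 U) (su2x genZ1 U) ∂(haarProbability (Matrix.specialUnitaryGroup (Fin 2) ℂ)) =
      ∫ t in (-1 : ℝ)..1, (2⁻¹ * ∫ s in (-1 : ℝ)..1, F t (Real.sqrt (1 - t ^ 2) * s)) *
        semicircleDensity t := by
  set ν : Measure ℝ := (2⁻¹ : NNReal) • (volume.restrict (Icc (-1 : ℝ) 1)) with hν
  haveI : IsFiniteMeasure (volume.restrict (Icc (-1 : ℝ) 1)) :=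
    ⟨by rw [Measure.restrict_apply_univ]; exact measure_Icc_lt_top⟩
  have hG : Continuous fun p : ℝ × ℝ => F p.1 (Real.sqrt (1 - p.1 ^ 2) * p.2) := by
    have h1 : Continuous fun p : ℝ × ℝ => (p.1, Real.sqrt (1 - p.1 ^ 2) * p.2) := by fun_prop
    exact hF.comp h1
  -- Step 1: the Haar integral as an integral against the law of `(a₀, T)`
  have h1 : ∫ U, F (su2a0 U) (su2x genZ1 U) ∂(haarProbability (Matrix.specialUnitaryGroup (Fin 2) ℂ)) =
      ∫ p, F p.1 (Real.sqrt (1 - p.1 ^ 2) * p.2)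
        ∂((haarProbability (Matrix.specialUnitaryGroup (Fin 2) ℂ)).map
          fun U => (su2a0 U, (su2axis U : E3) 0)) := by
    rw [integral_map measurable_a0_axisCoord.aemeasurable hG.aestronglyMeasurable]
    refine integral_congr_ae (Filter.Eventually.of_forall fun U => ?_)
    simp only
    rw [su2x_genZ1_eq_sqrt_mul_axisCoord]
  rw [h1, map_a0_axisCoord_haar]
  -- Step 2: Fubini (the integrand is bounded on the square carrying the product law)
  obtain ⟨M, hM⟩ := (isCompact_Icc.prod isCompact_Icc : IsCompact (Icc (-1 : ℝ) 1 ×ˢ Icc (-1 : ℝ) 1))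
    |>.exists_bound_of_continuousOn hG.continuousOn
  have hint : Integrable (fun p : ℝ × ℝ => F p.1 (Real.sqrt (1 - p.1 ^ 2) * p.2))
      (semicircleLaw.prod ν) :=
    Integrable.mono' (integrable_const M) hG.aestronglyMeasurable
      (ae_mem_Icc_prod_Icc.mono fun p hp => hM p hp)
  rw [integral_prod _ hint, integral_semicircleLaw]
  refine intervalIntegral.integral_congr fun t _ => ?_
  simp only
  congr 1
  rw [hν, integral_smul_nnreal_measure]
  have h2 : ∫ s in Icc (-1 : ℝ) 1, F t (Real.sqrt (1 - t ^ 2) * s) =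
      ∫ s in (-1 : ℝ)..1, F t (Real.sqrt (1 - t ^ 2) * s) := by
    rw [intervalIntegral.integral_of_le (by norm_num), integral_Icc_eq_integral_Ioc]
  rw [h2, NNReal.smul_def, smul_eq_mul]
  push_cast
  ring

/-! ## §2. `∫ U_m` over an affine segment: `T'_{m+1} = (m+1)·U_m` -/

/-- **`(m+1)·w·∫_{−1}^{1} U_m(c + w·s) ds = T_{m+1}(c + w) − T_{m+1}(c − w)`** (all real `c, w`; at
`w = 0` both sides vanish). -/
theorem mul_integral_chebyshevU_affine (m : ℕ) (c w : ℝ) :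
    ((m : ℝ) + 1) * w * ∫ s in (-1 : ℝ)..1, (U ℝ m).eval (c + w * s) =
      (T ℝ (m + 1)).eval (c + w) - (T ℝ (m + 1)).eval (c - w) := by
  have hder : Polynomial.derivative (T ℝ (m + 1)) = Polynomial.C ((m : ℝ) + 1) * U ℝ m := by
    have h := T_derivative_eq_U (R := ℝ) ((m : ℤ) + 1)
    rw [show ((m : ℤ) + 1 - 1 : ℤ) = m by ring] at h
    rw [h, map_add, map_natCast, map_one]
    push_cast
    rfl
  have hd : ∀ s ∈ uIcc (-1 : ℝ) 1, HasDerivAt (fun s : ℝ => (T ℝ (m + 1)).eval (c + w * s))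
      ((((m : ℝ) + 1) * (U ℝ m).eval (c + w * s)) * w) s := by
    intro s _
    have h1 : HasDerivAt (fun s : ℝ => c + w * s) w s := by
      simpa using ((hasDerivAt_id s).const_mul w).const_add c
    have h2 := ((T ℝ (m + 1)).hasDerivAt (c + w * s)).comp s h1
    rw [hder, Polynomial.eval_mul, Polynomial.eval_C] at h2
    exact h2
  have hc : Continuous fun s : ℝ => (((m : ℝ) + 1) * (U ℝ m).eval (c + w * s)) * w := by
    have := (U ℝ m).continuous
    fun_prop
  have hftc := integral_eq_sub_of_hasDerivAt hd (hc.intervalIntegrable _ _)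
  rw [show (fun s : ℝ => ((m : ℝ) + 1) * (U ℝ m).eval (c + w * s) * w) =
      fun s => (((m : ℝ) + 1) * w) * (U ℝ m).eval (c + w * s) by funext s; ring,
    intervalIntegral.integral_const_mul] at hftc
  rw [hftc]
  ring_nf

/-- **The two-angle integral of a character**:
`(m+1)·sin θ·sin a·∫_{−1}^{1} U_m(cos θ cos a + sin θ sin a·s) ds = 2 sin((m+1)θ) sin((m+1)a)`
(`cos θ cos a ± sin θ sin a = cos(θ ∓ a)` and `T_{m+1}(cos x) = cos((m+1)x)`). -/
theorem mul_integral_chebyshevU_twoAngle (m : ℕ) (θ a : ℝ) :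
    ((m : ℝ) + 1) * (Real.sin θ * Real.sin a) *
        ∫ s in (-1 : ℝ)..1, (U ℝ m).eval (Real.cos θ * Real.cos a + Real.sin θ * Real.sin a * s) =
      2 * Real.sin ((m + 1) * θ) * Real.sin ((m + 1) * a) := by
  have h := mul_integral_chebyshevU_affine m (Real.cos θ * Real.cos a) (Real.sin θ * Real.sin a)
  rw [h, ← Real.cos_sub, ← Real.cos_add]
  have hT : ∀ x : ℝ, (T ℝ (m + 1)).eval (Real.cos x) = Real.cos ((m + 1) * x) := fun x => by
    have := T_real_cos x ((m + 1 : ℕ) : ℤ)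
    push_cast at this
    exact this
  rw [hT, hT, Real.cos_sub_cos]
  have e1 : (((m : ℝ) + 1) * (θ - a) + ((m : ℝ) + 1) * (θ + a)) / 2 = (m + 1) * θ := by ring
  have e2 : (((m : ℝ) + 1) * (θ - a) - ((m : ℝ) + 1) * (θ + a)) / 2 = -((m + 1) * a) := by ring
  rw [e1, e2, Real.sin_neg]
  ring

/-! ## §3. The character convolution identity at the one-parameter subgroup `x_θ = cos θ + sin θ·Z₁` -/

/-- The orthogonality integral `∫₀^π sin((m+1)a)·(U_n(cos a) sin a) da = (π/2)[m = n]`. -/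
theorem integral_sin_succ_mul_chebyshevU_mul_sin (m n : ℕ) :
    ∫ a in (0 : ℝ)..π, Real.sin ((m + 1) * a) * ((U ℝ n).eval (Real.cos a) * Real.sin a) =
      if m = n then π / 2 else 0 := by
  simp_rw [chebyshevU_eval_cos_mul_sin]
  exact integral_sin_succ_mul_sin_succ m n

/-- **The two-angle integral, evaluated** (pure real analysis): for `sin θ ≠ 0` and `m, n ∈ ℕ`,
`∫_{−1}^{1} (½∫_{−1}^{1} U_m(cos θ·t + sin θ·√(1−t²)·s)·U_n(t) ds)·(2/π)√(1−t²) dt = [m = n]·U_n(cos θ)/(n+1)`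
(substitute `t = cos a`, use `mul_integral_chebyshevU_twoAngle` and the orthogonality
`∫₀^π sin((m+1)a) sin((n+1)a) da = (π/2)[m = n]`, then cancel `(m+1) sin θ ≠ 0`). -/
theorem twoAngle_integral_chebyshevU (m n : ℕ) {θ : ℝ} (hθ : Real.sin θ ≠ 0) :
    ∫ t in (-1 : ℝ)..1, (2⁻¹ * ∫ s in (-1 : ℝ)..1,
        (U ℝ m).eval (Real.cos θ * t + Real.sin θ * (Real.sqrt (1 - t ^ 2) * s)) * (U ℝ n).eval t) *
        semicircleDensity t =
      if m = n then (U ℝ n).eval (Real.cos θ) / (n + 1) else 0 := by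
  have hUm := (U ℝ m).continuous
  have hUn := (U ℝ n).continuous
  -- pull `U_n(t)` out of the inner integral
  simp_rw [intervalIntegral.integral_mul_const]
  -- substitute `t = cos a`
  set g : ℝ → ℝ := fun t => 2⁻¹ * ((∫ s in (-1 : ℝ)..1,
    (U ℝ m).eval (Real.cos θ * t + Real.sin θ * (Real.sqrt (1 - t ^ 2) * s))) * (U ℝ n).eval t) with hg
  have hgc : Continuous g := by
    have hin : Continuous fun t : ℝ => ∫ s in (-1 : ℝ)..1,
        (U ℝ m).eval (Real.cos θ * t + Real.sin θ * (Real.sqrt (1 - t ^ 2) * s)) := by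
      refine intervalIntegral.continuous_parametric_intervalIntegral_of_continuous' ?_ (-1) 1
      have h1 : Continuous fun p : ℝ × ℝ =>
          Real.cos θ * p.1 + Real.sin θ * (Real.sqrt (1 - p.1 ^ 2) * p.2) := by fun_prop
      exact hUm.comp h1
    have := hin.mul hUn
    simpa [hg] using this.const_mul (2⁻¹ : ℝ)
  have hsub := intervalIntegral_mul_semicircleDensity_eq g hgc
  rw [show (fun t => g t * semicircleDensity t) = fun t => 2⁻¹ * ((∫ s in (-1 : ℝ)..1,
      (U ℝ m).eval (Real.cos θ * t + Real.sin θ * (Real.sqrt (1 - t ^ 2) * s))) * (U ℝ n).eval t) *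
      semicircleDensity t from rfl] at hsub
  rw [hsub]
  -- the `a`-integrand, multiplied by `(m+1) sin θ`, is `sin((m+1)θ)·sin((m+1)a)·(U_n(cos a) sin a)`
  have hpt : ∀ a ∈ uIcc (0 : ℝ) π, ((m : ℝ) + 1) * Real.sin θ * (g (Real.cos a) * Real.sin a ^ 2) =
      Real.sin ((m + 1) * θ) * (Real.sin ((m + 1) * a) * ((U ℝ n).eval (Real.cos a) * Real.sin a)) := by
    intro a ha
    rw [uIcc_of_le Real.pi_pos.le] at ha
    have hs : Real.sqrt (1 - Real.cos a ^ 2) = Real.sin a := (Real.sin_eq_sqrt_one_sub_cos_sq ha.1 ha.2).symm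
    simp only [hg, hs]
    have hk := mul_integral_chebyshevU_twoAngle m θ a
    have e : (fun s : ℝ => (U ℝ m).eval (Real.cos θ * Real.cos a + Real.sin θ * (Real.sin a * s))) =
        fun s => (U ℝ m).eval (Real.cos θ * Real.cos a + Real.sin θ * Real.sin a * s) := by
      funext s; ring_nf
    rw [e]
    calc ((m : ℝ) + 1) * Real.sin θ * (2⁻¹ * ((∫ s in (-1 : ℝ)..1,
          (U ℝ m).eval (Real.cos θ * Real.cos a + Real.sin θ * Real.sin a * s)) *
            (U ℝ n).eval (Real.cos a)) * Real.sin a ^ 2)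
        = 2⁻¹ * (((m : ℝ) + 1) * (Real.sin θ * Real.sin a) * ∫ s in (-1 : ℝ)..1,
            (U ℝ m).eval (Real.cos θ * Real.cos a + Real.sin θ * Real.sin a * s)) *
            ((U ℝ n).eval (Real.cos a) * Real.sin a) := by ring
      _ = _ := by rw [hk]; ring
  have hI : ((m : ℝ) + 1) * Real.sin θ * ∫ a in (0 : ℝ)..π, g (Real.cos a) * Real.sin a ^ 2 =
      Real.sin ((m + 1) * θ) * ∫ a in (0 : ℝ)..π,
        Real.sin ((m + 1) * a) * ((U ℝ n).eval (Real.cos a) * Real.sin a) := by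
    rw [← intervalIntegral.integral_const_mul, ← intervalIntegral.integral_const_mul]
    exact intervalIntegral.integral_congr hpt
  have hL : ((m : ℝ) + 1) * Real.sin θ * (2 / π * ∫ a in (0 : ℝ)..π, g (Real.cos a) * Real.sin a ^ 2) =
      Real.sin ((m + 1) * θ) * (if m = n then 1 else 0) := by
    calc ((m : ℝ) + 1) * Real.sin θ * (2 / π * ∫ a in (0 : ℝ)..π, g (Real.cos a) * Real.sin a ^ 2)
        = 2 / π * (((m : ℝ) + 1) * Real.sin θ * ∫ a in (0 : ℝ)..π, g (Real.cos a) * Real.sin a ^ 2) := by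
          ring
      _ = 2 / π * (Real.sin ((m + 1) * θ) * ∫ a in (0 : ℝ)..π,
            Real.sin ((m + 1) * a) * ((U ℝ n).eval (Real.cos a) * Real.sin a)) := by rw [hI]
      _ = Real.sin ((m + 1) * θ) * (if m = n then 1 else 0) := by
          rw [integral_sin_succ_mul_chebyshevU_mul_sin]
          by_cases h : m = n
          · rw [if_pos h, if_pos h]; field_simp
          · rw [if_neg h, if_neg h]; ring
  -- conclude, dividing by `(m+1) sin θ ≠ 0`
  have hm : ((m : ℝ) + 1) * Real.sin θ ≠ 0 := mul_ne_zero (by positivity) hθ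
  by_cases h : m = n
  · subst h
    rw [if_pos rfl] at hL ⊢
    rw [mul_one, ← chebyshevU_eval_cos_mul_sin m θ] at hL
    have : ((m : ℝ) + 1) * Real.sin θ * (2 / π * ∫ a in (0 : ℝ)..π, g (Real.cos a) * Real.sin a ^ 2) =
        ((m : ℝ) + 1) * Real.sin θ * ((U ℝ m).eval (Real.cos θ) / (m + 1)) := by
      rw [hL]; field_simp
    exact mul_left_cancel₀ hm this
  · rw [if_neg h] at hL ⊢
    rw [mul_zero] at hL
    exact (mul_eq_zero.mp hL).resolve_left hm

/-- **THE CHARACTER CONVOLUTION IDENTITY (two-angle form).**  For `sin θ ≠ 0` and all `m, n ∈ ℕ`: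
`∫ U_m(cos θ·a₀(U) + sin θ·x₁(U))·U_n(a₀(U)) dHaar_SU(2)(U) = [m = n]·U_n(cos θ)/(n+1)`.
With `χ_n = U_n(a₀)` and `cos θ·a₀(U) + sin θ·x₁(U) = a₀(x_θ⁻¹U)`, `x_θ = cos θ·1 + sin θ·Z₁`, this is
`(χ_m ∗ χ_n)(x_θ) = ∫ χ_m(x_θ⁻¹U) χ_n(U) dU = [m = n]·χ_n(x_θ)/dim`, `dim = n + 1`. -/
theorem integral_chebyshevU_twoAngle_mul_chebyshevU (m n : ℕ) {θ : ℝ} (hθ : Real.sin θ ≠ 0) :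
    ∫ y, (U ℝ m).eval (Real.cos θ * su2a0 y + Real.sin θ * su2x genZ1 y) * (U ℝ n).eval (su2a0 y)
        ∂(haarProbability (Matrix.specialUnitaryGroup (Fin 2) ℂ)) =
      if m = n then (U ℝ n).eval (Real.cos θ) / (n + 1) else 0 := by
  have hF : Continuous (Function.uncurry fun t x : ℝ =>
      (U ℝ m).eval (Real.cos θ * t + Real.sin θ * x) * (U ℝ n).eval t) := by
    have h1 : Continuous fun p : ℝ × ℝ => Real.cos θ * p.1 + Real.sin θ * p.2 := by fun_prop
    exact ((U ℝ m).continuous.comp h1).mul ((U ℝ n).continuous.comp continuous_fst)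
  rw [integral_a0_su2x_haar (fun t x => (U ℝ m).eval (Real.cos θ * t + Real.sin θ * x) *
    (U ℝ n).eval t) hF]
  exact twoAngle_integral_chebyshevU m n hθ

end Summit.Ventures.LatticeQCDFlow.Scoring
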